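import Mathlib
import Summits.QuantumAdvantage.QuantumAdvantage.Theses.LinnikCubicClassGroups
import Summits.QuantumAdvantage.QuantumAdvantage.Theorems.PureCubicClassNumberHard.Negative.WellPosed
import Summits.QuantumAdvantage.QuantumAdvantage.Theorems.LinnikCubicClassGroupsPureCubicClassNumberHardHonda25
import Summits.QuantumAdvantage.QuantumAdvantage.Theorems.LinnikCubicClassGroupsPureCubicClassNumberHardHondaLeakTransfer
import Summits.QuantumAdvantage.QuantumAdvantage.Theorems.LinnikCubicClassGroupsPureCubicClassGroupFBQPStubClassStageAssembly
import Summits.QuantumAdvantage.QuantumAdvantage.Theorems.LinnikCubicClassGroupsPureCubicClassNumberHardStubGenus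
import Summits.QuantumAdvantage.QuantumAdvantage.Theorems.LinnikCubicClassGroupsPureCubicClassNumberHardStubReach
import HarnessLib

/-!
# The rung `FiftyBlindBitsRung` of the junta ladder under `PureCubicClassNumberHard` — PROVED

Crux `stmt-QuantumAdvantage-11826` (route `LinnikCubicClassGroups`, rank-0 HYPOTHESIS-TYPE target
`X = PureCubicClassNumberHard`: no PPT algorithm prints the `2|x|+8` low bits of `h(ℚ(∛m))`,
`m = decodeNat x`, with probability `≥ 2/3` on every non-cube `m`).  The forward ladder generator
(`Cruxes/PureCubicClassNumberHard/LADDER-PureCubicClassNumberHard.md`, line `Lines/JuntaLadder.lean`)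
graded `X` by the INFORMATION available to the adversary: `JuntaRung j` = "every PPT algorithm whose
output law at length `n` depends on at most `j n` (adversarially placed) input positions fails on some
non-cube input of every large length"; floor `j = 0` proved there, top `j = id` is `X` itself, and the
NEXT RUNG `FiftyBlindBitsRung = JuntaRung (n ↦ n − 50)` was reduced (kernel-checked,
`JuntaLadder.fiftyBlindBitsRung_of_stubs`) to two arithmetic stubs.  Both stubs are now theorems of
the tree:

* `stub_genus` (`…Theorems.LinnikCubicClassGroups.stub_genus`, from the Literature theorem
  `Honda1971.three_dvd_classNumber_of_padicValNat_eq_one`: genus theory for pure cubic fields with a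
  GENERAL radicand — a prime `ℓ ≡ 1 (mod 3)` with `ℓ ∥ m` forces `3 ∣ h(K)` for every cubic `K ∋ ∛m`);
* `stub_reach` (`…Theorems.LinnikCubicClassGroups.stub_reach`: `48` free non-top bit positions reach
  a value `≡ 7 (mod 49)` — subset sums of units cover `ℤ/49`).

This file assembles the rung in the `Theorems` tree (the line file lives under `Cruxes/` and is not
importable here), with `IsBlindOff`/`JuntaRung` unfolded verbatim and the target function
`targetBits` of `Theorems/PureCubicClassNumberHard/Negative/WellPosed.lean`:

* `fiftyBlindBits_fooling` — **for EVERY randomized algorithm `A` (no running-time hypothesis) whose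
  output law at length `n` ignores all but `≤ n − 50` input positions, and every `n₀`, there is a
  non-cube input `x` of length `≥ n₀` with `Pr[A(x) = targetBits x] < 2/3`**;
* `fiftyBlindBitsRung` — the rung as filed (`JuntaRung (fun n => n - 50)` unfolded: PPT `A`);
* `fiftyBlindBits_fooling_fields` — the same with the crux's own `∀ K` phrasing of the target
  (the `2|x|+8` low bits of `NumberField.classNumber K` for every cubic `K ∋ ∛(decodeNat x)`).

Proof (the line's, `JuntaLadder.fiftyBlindBitsRung_of_stubs`): Dirichlet gives a prime
`q ≡ 5 (mod 9)` beyond `2^{n₀+60}`; `x = encodeNat (2q)` has `3 ∤ h(ℚ(∛(2q)))` (`honda25`, Honda's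
case (v)); the `≥ 48` free non-top positions move `x` to `x'` of the same length, agreeing with `x` on
the read positions, with `decodeNat x' ≡ 7 (mod 49)` (`stub_reach`), so `7 ∥ decodeNat x'` and
`3 ∣ h(ℚ(∛(decodeNat x')))` (`stub_genus`); both class numbers fit in the window `2|x|+8`
(`classNumber_lt_window`), so the two targets differ, while a blind algorithm has the same output
law on `x` and `x'` — it misses one of them with probability `≥ 1/2 > 1/3`.

HONEST FRAMING (block-2b rule): this is an unconditional information-theoretic rung BELOW a
hypothesis-type crux — a theorem, NOT summit progress; the climb `n − 50 → n` (`stub_climb`) is the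
crux itself and is not claimed.
-/

namespace Summit.QuantumAdvantage.QuantumAdvantage.Theorems.LinnikCubicClassGroups

open Literature.Computability.Complexity _root_.Computability
open Summit.QuantumAdvantage.QuantumAdvantage.Theorems.PureCubicClassNumberHard.Negative
  (targetBits bitsOf targetBits_eq pr_add_pr_le_one nonempty_admissible classNumber_eq_of_admissible)

/-- `p ∥ m` (`v_p(m) = 1`) makes `m` a non-cube. [folklore] -/
theorem not_cube_of_padicValNat_eq_one' {p m : ℕ} (hp : p.Prime) (h : padicValNat p m = 1) :
    ∀ r : ℕ, r ^ 3 ≠ m := by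
  intro r hr
  haveI := Fact.mk hp
  have hv := congrArg (padicValNat p) hr
  rw [padicValNat.pow r 3, h] at hv
  omega

/-- `m ≡ 7 (mod 49)` gives `7 ∥ m`. [folklore] -/
theorem padicValNat_seven_of_mod_eq_seven {m : ℕ} (h : m % 49 = 7) : padicValNat 7 m = 1 := by
  haveI := Fact.mk (by norm_num : Nat.Prime 7)
  have hm0 : m ≠ 0 := by rintro rfl; simp at h
  have h7 : 7 ∣ m := by omega
  have h49 : ¬ 7 ^ 2 ∣ m := by norm_num; omega
  have h1 : 1 ≤ padicValNat 7 m := one_le_padicValNat_of_dvd hm0 h7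
  have h2 : ¬ 2 ≤ padicValNat 7 m := by rwa [← padicValNat_dvd_iff_le hm0]
  omega

/-- **The fooling argument, for every randomized algorithm** (no running-time hypothesis): if the
output law of `A` at length `n` depends only on the input bits at `≤ n − 50` positions `J n`, then for
every `n₀` some non-cube input `x` of length `≥ n₀` has `Pr[A(x) = targetBits x] < 2/3`. [folklore] -/
theorem fiftyBlindBits_fooling_of
    (hg : ∀ (ℓ m : ℕ), ℓ.Prime → ℓ % 3 = 1 → padicValNat ℓ m = 1 →
      ∀ (K : Type) [Field K] [NumberField K], Module.finrank ℚ K = 3 →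
        ∀ α : K, α ^ 3 = (m : K) → 3 ∣ NumberField.classNumber K)
    (hr : ∀ (m : ℕ) (F : Finset ℕ), 0 < m → F ⊆ Finset.range ((encodeNat m).length - 1) →
      48 ≤ F.card → ∃ x' : List Bool, x'.length = (encodeNat m).length ∧
        (∀ i : ℕ, i ∉ F → x'[i]? = (encodeNat m)[i]?) ∧ decodeNat x' % 49 = 7)
    (A : RandAlg (List Bool) (List Bool)) (J : ℕ → Finset ℕ) (hJ : ∀ n, (J n).card ≤ n - 50)
    (hB : ∀ x x' : List Bool, x.length = x'.length → (∀ i ∈ J x.length, x[i]? = x'[i]?) →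
      ∀ E : Set (List Bool), A.pr id x E = A.pr id x' E)
    (n₀ : ℕ) :
    ∃ x : List Bool, n₀ ≤ x.length ∧ (∀ r : ℕ, r ^ 3 ≠ decodeNat x) ∧
      A.pr id x {targetBits x} < 2 / 3 := by
  classical
  -- a prime q ≡ 5 (mod 9) beyond 2 ^ (n₀ + 60)
  have h5 : IsUnit (5 : ZMod 9) := IsUnit.of_mul_eq_one (2 : ZMod 9) (by decide)
  obtain ⟨q, hqgt, hq, hq9⟩ := Nat.forall_exists_prime_gt_and_eq_mod h5 (2 ^ (n₀ + 60))
  have hq9' : q % 9 = 5 := by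
    have hv := congrArg ZMod.val hq9
    rwa [ZMod.val_natCast] at hv
  have hxm : decodeNat (encodeNat (2 * q)) = 2 * q := decode_encodeNat _
  -- its encoding is long
  have hlen : n₀ + 59 ≤ (encodeNat (2 * q)).length := by
    by_contra hlt
    have h1 : 2 * q < 2 ^ (n₀ + 58 + 1) := lt_two_pow_of_size_le (by omega)
    have h2 : 2 ^ (n₀ + 58 + 1) ≤ 2 ^ (n₀ + 60) := Nat.pow_le_pow_right (by norm_num) (by omega)
    omega
  -- at least 48 free non-top positions
  have hFcard : 48 ≤ (Finset.range ((encodeNat (2 * q)).length - 1) \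
      J (encodeNat (2 * q)).length).card := by
    have h1 := Finset.card_le_card_sdiff_add_card (s := Finset.range ((encodeNat (2 * q)).length - 1))
      (t := J (encodeNat (2 * q)).length)
    have h2 : (J (encodeNat (2 * q)).length).card ≤ (encodeNat (2 * q)).length - 50 := hJ _
    simp only [Finset.card_range] at h1
    omega
  obtain ⟨x', hlen', hagree, hmod⟩ :=
    hr (2 * q) _ (by have := hq.pos; omega) Finset.sdiff_subset hFcard
  -- a blind algorithm has the same output law on both inputs
  have hbl : ∀ E, A.pr id (encodeNat (2 * q)) E = A.pr id x' E := by
    refine hB _ _ hlen'.symm (fun i hi => ?_)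
    exact (hagree i (fun hiF => (Finset.mem_sdiff.mp hiF).2 hi)).symm
  -- both inputs are non-cubes
  haveI : Fact (Nat.Prime 2) := ⟨Nat.prime_two⟩
  haveI : Fact q.Prime := ⟨hq⟩
  have hq2 : (2 : ℕ) ≠ q := by omega
  have hv2 : padicValNat 2 (2 * q) = 1 := by
    rw [padicValNat.mul (by norm_num) hq.ne_zero, padicValNat_self, padicValNat_primes hq2]
  have hm_nc : ∀ r : ℕ, r ^ 3 ≠ decodeNat (encodeNat (2 * q)) := by
    rw [hxm]; exact not_cube_of_padicValNat_eq_one' Nat.prime_two hv2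
  have hv7 : padicValNat 7 (decodeNat x') = 1 := padicValNat_seven_of_mod_eq_seven hmod
  have hm'_nc : ∀ r : ℕ, r ^ 3 ≠ decodeNat x' :=
    not_cube_of_padicValNat_eq_one' (by norm_num) hv7
  -- the fields: 3 ∤ h on the first (Honda), 3 ∣ h on the second (genus at 7)
  obtain ⟨⟨K, h3, hα⟩⟩ := nonempty_admissible hm_nc
  obtain ⟨⟨K', h3', hα'⟩⟩ := nonempty_admissible hm'_nc
  have hK : ¬ 3 ∣ NumberField.classNumber K := by
    refine honda25 2 q Nat.prime_two hq (by norm_num) hq9' K h3 ?_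
    obtain ⟨α, hα⟩ := hα
    exact ⟨α, by rw [hα, hxm]⟩
  have hK' : 3 ∣ NumberField.classNumber K' := by
    obtain ⟨α', hα'⟩ := hα'
    exact hg 7 (decodeNat x') (by norm_num) (by norm_num) hv7 K' h3' α' hα'
  have hne : NumberField.classNumber K ≠ NumberField.classNumber K' := fun h => hK (h ▸ hK')
  -- so the two targets differ inside the window
  have hT : targetBits (encodeNat (2 * q)) ≠ targetBits x' := by
    rw [targetBits_eq _ hm_nc K h3 hα, targetBits_eq x' hm'_nc K' h3' hα']
    intro h
    have hltK := classNumber_lt_window (encodeNat (2 * q)) K h3 hm_nc hα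
    have hltK' := classNumber_lt_window x' K' h3' hm'_nc hα'
    rw [hlen'] at hltK'
    unfold bitsOf at h
    rw [hlen'] at h
    have hfun := List.ofFn_injective h
    apply hne
    refine Nat.eq_of_testBit_eq fun t => ?_
    by_cases ht : t < 2 * (encodeNat (2 * q)).length + 8
    · exact congrFun hfun ⟨t, ht⟩
    · have h2 : 2 ^ (2 * (encodeNat (2 * q)).length + 8) ≤ 2 ^ t :=
        Nat.pow_le_pow_right (by norm_num) (not_lt.1 ht)
      rw [Nat.testBit_lt_two_pow (lt_of_lt_of_le hltK h2),
        Nat.testBit_lt_two_pow (lt_of_lt_of_le hltK' h2)]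
  -- and one of the two inputs defeats `A`
  by_cases hxA : A.pr id (encodeNat (2 * q)) {targetBits (encodeNat (2 * q))} < 2 / 3
  · exact ⟨encodeNat (2 * q), by omega, hm_nc, hxA⟩
  · refine ⟨x', by rw [hlen']; omega, hm'_nc, ?_⟩
    have hsum := pr_add_pr_le_one A (encodeNat (2 * q)) hT
    rw [← hbl]
    have hge := not_lt.mp hxA
    linarith

/-- **The rung `FiftyBlindBitsRung`, unconditionally and for EVERY randomized algorithm** (no
running-time hypothesis): if the output law of `A` at length `n` depends only on the input bits at
`≤ n − 50` positions, then for every `n₀` some non-cube input `x` of length `≥ n₀` has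
`Pr[A(x) = targetBits x] < 2/3`.  (`fiftyBlindBits_fooling_of` with the landed stubs `stub_genus`,
`stub_reach`.) [folklore] -/
theorem fiftyBlindBits_fooling (A : RandAlg (List Bool) (List Bool)) (J : ℕ → Finset ℕ)
    (hJ : ∀ n, (J n).card ≤ n - 50)
    (hB : ∀ x x' : List Bool, x.length = x'.length → (∀ i ∈ J x.length, x[i]? = x'[i]?) →
      ∀ E : Set (List Bool), A.pr id x E = A.pr id x' E)
    (n₀ : ℕ) :
    ∃ x : List Bool, n₀ ≤ x.length ∧ (∀ r : ℕ, r ^ 3 ≠ decodeNat x) ∧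
      A.pr id x {targetBits x} < 2 / 3 :=
  fiftyBlindBits_fooling_of stub_genus stub_reach A J hJ hB n₀

/-- **`FiftyBlindBitsRung` as filed** — `LadderDown.JuntaRung (fun n => n - 50)` of
`Cruxes/PureCubicClassNumberHard/Lines/JuntaLadder.lean` with `IsBlindOff`/`JuntaRung` unfolded
verbatim (target function `targetBits` of `Theorems/PureCubicClassNumberHard/Negative/WellPosed.lean`):
every PPT algorithm reading (in law) at most `n − 50` adversarially placed positions of an `n`-bit
input fails, at arbitrarily large lengths, to print the class-number window of `ℚ(∛m)` with
probability `≥ 2/3`.  The polynomial-time hypothesis is not used (`fiftyBlindBits_fooling`). [folklore] -/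
theorem fiftyBlindBitsRung :
    ∀ A : RandAlg (List Bool) (List Bool), A.IsPolyTime id id →
      ∀ J : ℕ → Finset ℕ, (∀ n, (J n).card ≤ n - 50) →
        (∀ x x' : List Bool, x.length = x'.length → (∀ i ∈ J x.length, x[i]? = x'[i]?) →
          ∀ E : Set (List Bool), A.pr id x E = A.pr id x' E) →
        ∀ n₀ : ℕ, ∃ x : List Bool, n₀ ≤ x.length ∧ (∀ r : ℕ, r ^ 3 ≠ decodeNat x) ∧
          A.pr id x {targetBits x} < 2 / 3 :=
  fun A _ J hJ hB n₀ => fiftyBlindBits_fooling A J hJ hB n₀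

/-- **The rung in the crux's own phrasing** (`∀ K`, the `2|x|+8` low bits of
`NumberField.classNumber K`): for every randomized algorithm blind (in law) to all but `≤ n − 50`
positions and every `n₀` there is a non-cube input `x`, `|x| ≥ n₀`, such that for EVERY cubic number
field `K ∋ ∛(decodeNat x)` the success probability of printing the window of `h(K)` is `< 2/3`
(all such `K` are isomorphic: `targetBits_eq`). [folklore] -/
theorem fiftyBlindBits_fooling_fields (A : RandAlg (List Bool) (List Bool)) (J : ℕ → Finset ℕ)
    (hJ : ∀ n, (J n).card ≤ n - 50)
    (hB : ∀ x x' : List Bool, x.length = x'.length → (∀ i ∈ J x.length, x[i]? = x'[i]?) →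
      ∀ E : Set (List Bool), A.pr id x E = A.pr id x' E)
    (n₀ : ℕ) :
    ∃ x : List Bool, n₀ ≤ x.length ∧ (∀ r : ℕ, r ^ 3 ≠ decodeNat x) ∧
      ∀ (K : Type) [Field K] [NumberField K], Module.finrank ℚ K = 3 →
        (∃ α : K, α ^ 3 = (decodeNat x : K)) →
          A.pr id x {List.ofFn (fun i : Fin (2 * x.length + 8) =>
            (NumberField.classNumber K).testBit i.val)} < 2 / 3 := by
  obtain ⟨x, hx, hnc, hlt⟩ := fiftyBlindBits_fooling A J hJ hB n₀
  refine ⟨x, hx, hnc, fun K _ _ h3 hα => ?_⟩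
  rw [targetBits_eq x hnc K h3 hα] at hlt
  exact hlt

end Summit.QuantumAdvantage.QuantumAdvantage.Theorems.LinnikCubicClassGroups
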